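import Literature.NumberTheory.Automorphic.HarishChandraGLTwist
import Literature.NumberTheory.Automorphic.HarishChandraGLParameterOfCharacter
import Literature.NumberTheory.Automorphic.ArchimedeanCharacterTwist
import Literature.NumberTheory.Automorphic.ArchParameterTwistNorm
import Literature.NumberTheory.Automorphic.GLOneArchParameterOfAlgebraicCharacter
import HarnessLib

/-!
# Harish-Chandra parameters under the twist by a COMPLEX-valued character of `𝔤𝔩ₙ(𝕜)`

Topic `NumberTheory/Automorphic`; a proof file (theorems only: no definition, no named fact, no
instance), companion of `HarishChandraGLTwist`. `𝕜` is `ℝ` or `ℂ`, `𝔤 = 𝔤𝔩ₙ(𝕜)` as a real Lie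
algebra, `HasHCParameter ρ χ` the predicate of `HarishChandraGL`. The tree's
`HasHCParameter.of_add_smul_one` shifts the Harish-Chandra parameter under the twist `ρ ↦ ρ + δ · 1`
by a REAL linear form `δ` of `𝔤` (the differential of `|det|_w^s`, `s` real: the shift
endomorphism `X ↦ X + δ(X)` of the real enveloping algebra needs `δ` real). The twist
`π ⊗ (θ ∘ det)` of an automorphic representation by an ARBITRARY idèle class character `θ`
(e.g. `θ = |·|^{iy} θ_alg`; Borel–Jacquet 1979, 5.7: "every cuspidal `π` is `π₀ ⊗ χ`") has a
complex-valued differential `Y ↦ L(tr Y)`, `L : 𝕜 → ℂ` real-linear; this file proves the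
corresponding shift of parameters.

* `exists_polynomial_lift_add_cmul_eq` — along the family `ρ_t = ρ + t λ · 1` (`λ` real, `t ∈ ℂ`)
  every element of `U(𝔤)` acts by an operator polynomial in `t`.
* `HasHCParameter.of_add_cmul_one` — **complex multiples of a real character**: if
  `ρ' = ρ + s λ · 1` with `λ` real (vanishing on brackets and on `𝔫`,
  `λ(diag h) = ∑_τ c_τ ∑_i τ(h_i)`) and `s ∈ ℂ`, a parameter `χ` of `ρ` gives the parameter
  `τ ↦ χ τ + s c_τ` of `ρ'`. Proof: for real `s` this is `of_add_smul_one`; the action of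
  `z ∈ Z(𝔤)` in `ρ_s` and the predicted scalar `γ(z)(l + s c)` are polynomials in `s` agreeing on
  `ℝ`, hence everywhere (Vandermonde, `mem_of_forall_sum_ofReal_pow_smul_mem`); the Harish-Chandra
  homomorphism is unique (`harishChandraHomGL_unique_holds`) and symmetric
  (`aeval_eq_aeval_of_map_univ_eq`).
* `HasHCParameter.of_twist_trace_real`, `HasHCParameter.of_twist_trace_complex` — **the twist by
  `Y ↦ L(tr Y) · 1` shifts the parameter by `τ ↦ proj L τ 1`** (`L(1)` for `𝕜 = ℝ`;
  `½ (L 1 ∓ i L i)` at `τ = id, conj` for `𝕜 = ℂ`, i.e. `p` and `q` for `L(a) = a p + ā q`):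
  `L(tr Y) = re(tr Y) L(1) + im(tr Y) L(i)`, two applications of `of_add_cmul_one`.

Consumer: the archimedean parameter of the Borel–Jacquet twist `π ⊗ (θ ∘ det)` for an arbitrary
Hecke character `θ` (`Summits/Langlands/…/IrreducibilityBySelfDualityRegularTwistCMTwistRealisation`).

## References

* A. Borel, H. Jacquet, *Automorphic forms and automorphic representations*, Corvallis 1979,
  part 1, §5.7. [BorelJacquetCorvallis1979]
* A. W. Knapp, *Lie Groups Beyond an Introduction*, 2nd ed. (2002), §V.5, Thm. 5.44. [Knapp2002]
* K. Buzzard, T. Gee, *The conjectural connections between automorphic representations and Galois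
  representations* (2014), §3.1. [BuzzardGee2014]
-/

open scoped BigOperators Classical ComplexConjugate Polynomial

-- Mathlib idiom (Mathlib/Algebra/Lie/OfAssociative.lean): the commutator bracket on matrices and on `End V`;
-- needed to state Lie algebra representations `𝔤𝔩ₙ →ₗ⁅ℝ⁆ End V` (as in `HarishChandraGL`, `HarishChandraGLTwist`)
attribute [local instance 100] LieRing.ofAssociativeRing

noncomputable section

namespace Literature.NumberTheory.Automorphic

variable {𝕜 : Type*} [RCLike 𝕜] {n : ℕ} {V V' : Type*} [AddCommGroup V] [Module ℂ V]
  [AddCommGroup V'] [Module ℂ V']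

/-! ### The family `ρ_t = ρ + t λ · 1` acts polynomially in `t` -/

/-- **Polynomial dependence on the twisting parameter.** For the family of twisted actions
`ρ_t X = ρ X + t λ(X) · 1` (`λ : 𝔤𝔩ₙ(𝕜) → ℝ` real-linear, `t ∈ ℂ`) and every `u ∈ U(𝔤)`, the
operator `U(ρ_t)(u)` is the value at `t` of a polynomial with coefficients in `End V` (induction on
`u`: constants, generators, sums, products). Dixmier, *Enveloping Algebras*, 2.2; Borel–Jacquet
1979, 5.7. [folklore] -/
theorem exists_polynomial_lift_add_cmul_eq (ρ : Matrix (Fin n) (Fin n) 𝕜 →ₗ⁅ℝ⁆ Module.End ℂ V)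
    (lam : Matrix (Fin n) (Fin n) 𝕜 →ₗ[ℝ] ℝ)
    (ρs : ℂ → (Matrix (Fin n) (Fin n) 𝕜 →ₗ⁅ℝ⁆ Module.End ℂ V))
    (hρs : ∀ (t : ℂ) (X : Matrix (Fin n) (Fin n) 𝕜),
      ρs t X = ρ X + (t * (lam X : ℂ)) • (1 : Module.End ℂ V))
    (u : UniversalEnvelopingAlgebra ℝ (Matrix (Fin n) (Fin n) 𝕜)) :
    ∃ P : Polynomial (Module.End ℂ V), ∀ t : ℂ,
      UniversalEnvelopingAlgebra.lift ℝ (ρs t) u =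
        P.eval₂ (RingHom.id _) (algebraMap ℂ (Module.End ℂ V) t) := by
  refine UniversalEnvelopingAlgebra.induction_on'
    (C := fun u => ∃ P : Polynomial (Module.End ℂ V), ∀ t : ℂ,
      UniversalEnvelopingAlgebra.lift ℝ (ρs t) u = P.eval₂ (RingHom.id _) (algebraMap ℂ (Module.End ℂ V) t))
    u (fun r => ?_) (fun X => ?_) (fun a b ha hb => ?_) (fun a b ha hb => ?_)
  · refine ⟨Polynomial.C (algebraMap ℝ (Module.End ℂ V) r), fun t => ?_⟩
    rw [AlgHom.commutes, Polynomial.eval₂_C, RingHom.id_apply]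
  · refine ⟨Polynomial.C (ρ X) + Polynomial.C ((lam X : ℂ) • (1 : Module.End ℂ V)) * Polynomial.X,
      fun t => ?_⟩
    rw [UniversalEnvelopingAlgebra.lift_ι_apply, hρs, Polynomial.eval₂_add, Polynomial.eval₂_C,
      Polynomial.eval₂_mul_X, Polynomial.eval₂_C, RingHom.id_apply, RingHom.id_apply,
      Algebra.algebraMap_eq_smul_one, smul_mul_smul_comm, one_mul, mul_comm]
  · obtain ⟨Pa, hPa⟩ := ha
    obtain ⟨Pb, hPb⟩ := hb
    refine ⟨Pa * Pb, fun t => ?_⟩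
    rw [map_mul, hPa, hPb, Polynomial.eval₂_mul_noncomm]
    exact fun k => Algebra.commute_algebraMap_right _ _
  · obtain ⟨Pa, hPa⟩ := ha
    obtain ⟨Pb, hPb⟩ := hb
    exact ⟨Pa + Pb, fun t => by rw [map_add, hPa, hPb, Polynomial.eval₂_add]⟩

/-- `P(t) = ∑_{k < N} t^k · P_k` for an operator polynomial `P` of degree `< N` evaluated at the
scalar `t`. [folklore] -/
theorem eval₂_algebraMap_eq_sum (P : Polynomial (Module.End ℂ V)) {N : ℕ} (hN : P.natDegree < N)
    (t : ℂ) :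
    P.eval₂ (RingHom.id _) (algebraMap ℂ (Module.End ℂ V) t) =
      ∑ k ∈ Finset.range N, t ^ k • P.coeff k := by
  rw [Polynomial.eval₂_eq_sum_range' (RingHom.id _) hN]
  refine Finset.sum_congr rfl fun k _ => ?_
  rw [RingHom.id_apply, ← map_pow, ← Algebra.commutes, ← Algebra.smul_def]

/-- `Q(t) · 1 = ∑_{k < N} t^k · (Q_k · 1)` for a scalar polynomial `Q` of degree `< N`. [folklore] -/
theorem algebraMap_eval_eq_sum (Q : ℂ[X]) {N : ℕ} (hN : Q.natDegree < N) (t : ℂ) :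
    algebraMap ℂ (Module.End ℂ V) (Q.eval t) =
      ∑ k ∈ Finset.range N, t ^ k • algebraMap ℂ (Module.End ℂ V) (Q.coeff k) := by
  rw [Polynomial.eval_eq_sum_range' hN, map_sum]
  refine Finset.sum_congr rfl fun k _ => ?_
  rw [map_mul, ← Algebra.commutes, ← Algebra.smul_def]

/-! ### Twisting by a complex multiple of a real character -/

/-- **Harish-Chandra parameter of the twist by `s λ`, `λ` real, `s` complex.** Let
`ρ' X = ρ X + s λ(X) · 1` with `λ` a real linear form on `𝔤𝔩ₙ(𝕜)` vanishing on brackets and on `𝔫`,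
`λ(diag h) = ∑_τ c_τ ∑_i τ(h_i)`, and `s ∈ ℂ`. If `(V, ρ)` has Harish-Chandra parameter `χ`, then
`(V, ρ')` has parameter `τ ↦ χ τ + s c_τ`. For real `s` this is the tree's
`HasHCParameter.of_add_smul_one` (Knapp 2002, Thm. 5.44); in general, `z ∈ Z(𝔤)` acts in
`ρ_s = ρ + s λ · 1` by an operator polynomial in `s` (`exists_polynomial_lift_add_cmul_eq`) which agrees with
the scalar polynomial `γ(z)(l + s c)` for all real `s`, hence for all `s` (Vandermonde); the clause
"for every Harish-Chandra homomorphism and every enumeration" follows from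
`harishChandraHomGL_unique_holds` and the symmetry of `γ(z)` (`aeval_eq_aeval_of_map_univ_eq`).
Borel–Jacquet 1979, 5.7 (`π ⊗ χ` for an arbitrary quasi-character `χ`); Knapp 2002, Thm. 5.44.
[cite: Knapp2002, §V.5 Thm. 5.44] -/
theorem HasHCParameter.of_add_cmul_one {lam : Matrix (Fin n) (Fin n) 𝕜 →ₗ[ℝ] ℝ}
    (hlam : ∀ X Y : Matrix (Fin n) (Fin n) 𝕜, lam ⁅X, Y⁆ = 0)
    (hlamn : ∀ X ∈ upperNilpLie 𝕜 n, lam X = 0) {c : (𝕜 →ₐ[ℝ] ℂ) → ℂ}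
    (hlamc : ∀ h : Fin n → 𝕜,
      ((lam (Matrix.diagonal h) : ℝ) : ℂ) = weightFun (fun τ (_ : Fin n) => c τ) h)
    (s : ℂ) {ρ ρ' : Matrix (Fin n) (Fin n) 𝕜 →ₗ⁅ℝ⁆ Module.End ℂ V}
    (hρ' : ∀ X, ρ' X = ρ X + (s * (lam X : ℂ)) • (1 : Module.End ℂ V))
    {χ : (𝕜 →ₐ[ℝ] ℂ) → Multiset ℂ} (hχ : HasHCParameter ρ χ) :
    HasHCParameter ρ' fun τ => (χ τ).map (· + s * c τ) := by
  classical
  -- the family of twisted actions `ρ_t X = ρ X + t λ(X)`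
  have hex : ∀ t : ℂ, ∃ ρt : Matrix (Fin n) (Fin n) 𝕜 →ₗ⁅ℝ⁆ Module.End ℂ V,
      ∀ X, ρt X = ρ X + (t * (lam X : ℂ)) • (1 : Module.End ℂ V) := fun t => by
    obtain ⟨ρt, h⟩ := exists_lieHom_add_smul_one ρ (t • (Complex.ofRealAm.toLinearMap.comp lam))
      (fun X Y => by
        rw [LinearMap.smul_apply, LinearMap.comp_apply, hlam]
        simp)
    exact ⟨ρt, fun X => by rw [h]; rfl⟩
  choose ρs hρs using hex
  have hρ's : ρ' = ρs s := LieHom.ext fun X => by rw [hρ', hρs]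
  -- real parameters: the tree's real shift
  have hreal : ∀ r : ℝ, HasHCParameter (ρs r) fun τ => (χ τ).map (· + (r : ℂ) * c τ) := by
    intro r
    have h1 : ∀ X Y : Matrix (Fin n) (Fin n) 𝕜, (r • lam) ⁅X, Y⁆ = 0 := fun X Y => by
      rw [LinearMap.smul_apply, hlam, smul_zero]
    have h2 : ∀ X ∈ upperNilpLie 𝕜 n, (r • lam) X = 0 := fun X hX => by
      rw [LinearMap.smul_apply, hlamn X hX, smul_zero]
    have h3 : ∀ h : Fin n → 𝕜, (((r • lam) (Matrix.diagonal h) : ℝ) : ℂ) =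
        weightFun (fun τ (_ : Fin n) => (r : ℂ) * c τ) h := fun h => by
      rw [LinearMap.smul_apply, smul_eq_mul, Complex.ofReal_mul, hlamc]
      simp only [weightFun, Finset.mul_sum, mul_assoc]
    have h4 : ∀ X, ρs r X = ρ X + (((r • lam) X : ℝ) : ℂ) • (1 : Module.End ℂ V) := fun X => by
      rw [hρs, LinearMap.smul_apply, smul_eq_mul, Complex.ofReal_mul]
    exact HasHCParameter.of_add_smul_one h1 h2 h3 h4 hχ
  -- the Harish-Chandra homomorphism and an enumeration of `χ`
  set γ₀ : HarishChandraHomGL 𝕜 n := harishChandraHomGL 𝕜 n with hγ₀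
  choose l₀ hl₀ using fun τ => exists_enum_of_card_eq' (χ τ) (hχ.1 τ)
  set l : ℂ → (𝕜 →ₐ[ℝ] ℂ) → Fin n → ℂ := fun t τ i => l₀ τ i + t * c τ with hl
  have hlt : ∀ (t : ℂ) (τ : 𝕜 →ₐ[ℝ] ℂ),
      Finset.univ.val.map (l t τ) = (χ τ).map (· + t * c τ) := fun t τ => by
    rw [← hl₀ τ, Multiset.map_map]
    rfl
  -- the scalar polynomial `t ↦ γ(z)(l + t c)`
  have hQ : ∀ z, ∃ Q : ℂ[X], ∀ t : ℂ,
      MvPolynomial.aeval (fun p : (𝕜 →ₐ[ℝ] ℂ) × Fin n => l t p.1 p.2) (γ₀.toAlgHom z) = Q.eval t := by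
    intro z
    refine ⟨MvPolynomial.aeval (fun p : (𝕜 →ₐ[ℝ] ℂ) × Fin n =>
      Polynomial.C (l₀ p.1 p.2) + Polynomial.C (c p.1) * Polynomial.X) (γ₀.toAlgHom z), fun t => ?_⟩
    rw [← Polynomial.coe_aeval_eq_eval, MvPolynomial.comp_aeval_apply]
    have hfun : (fun p : (𝕜 →ₐ[ℝ] ℂ) × Fin n => Polynomial.aeval t
        (Polynomial.C (l₀ p.1 p.2) + Polynomial.C (c p.1) * Polynomial.X)) = fun p => l t p.1 p.2 := by
      funext p
      simp only [map_add, map_mul, Polynomial.aeval_C, Polynomial.aeval_X, Algebra.algebraMap_self,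
        RingHom.id_apply, hl]
      ring
    rw [hfun]
  let θ' : Subalgebra.center ℝ (UniversalEnvelopingAlgebra ℝ (Matrix (Fin n) (Fin n) 𝕜)) →ₐ[ℝ] ℂ :=
    ((MvPolynomial.aeval (fun p : (𝕜 →ₐ[ℝ] ℂ) × Fin n => l s p.1 p.2)).restrictScalars ℝ).comp
      γ₀.toAlgHom
  have hθ' : ∀ z, θ' z = MvPolynomial.aeval (fun p : (𝕜 →ₐ[ℝ] ℂ) × Fin n => l s p.1 p.2)
      (γ₀.toAlgHom z) := fun z => rfl
  refine ⟨fun τ => by rw [Multiset.card_map, hχ.1], θ', fun z => ?_, fun γ l' hl' z => ?_⟩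
  · -- the central character of `ρ_s`: a polynomial identity in `s`
    obtain ⟨P, hP⟩ := exists_polynomial_lift_add_cmul_eq ρ lam ρs hρs z
    obtain ⟨Q, hQ⟩ := hQ z
    have hagree : ∀ r : ℝ, P.eval₂ (RingHom.id _) (algebraMap ℂ _ (r : ℂ)) =
        algebraMap ℂ (Module.End ℂ V) (Q.eval r) := fun r => by
      obtain ⟨-, θr, hθr, hθrχ⟩ := hreal r
      rw [← hP, hθr z, hθrχ γ₀ (l r) (hlt r) z, hQ]
    set m : ℕ := max P.natDegree Q.natDegree with hm
    have hPm : P.natDegree < m + 1 := Nat.lt_succ_of_le (le_max_left _ _)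
    have hQm : Q.natDegree < m + 1 := Nat.lt_succ_of_le (le_max_right _ _)
    have hexpand : ∀ t : ℂ, P.eval₂ (RingHom.id _) (algebraMap ℂ _ t) -
        algebraMap ℂ (Module.End ℂ V) (Q.eval t) =
          ∑ k ∈ Finset.range (m + 1),
            t ^ k • (P.coeff k - algebraMap ℂ (Module.End ℂ V) (Q.coeff k)) := fun t => by
      rw [eval₂_algebraMap_eq_sum P hPm, algebraMap_eval_eq_sum Q hQm, ← Finset.sum_sub_distrib]
      refine Finset.sum_congr rfl fun k _ => ?_
      rw [smul_sub]
    have hzero := mem_of_forall_sum_ofReal_pow_smul_mem (⊥ : Submodule ℂ (Module.End ℂ V))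
      (fun k => P.coeff k - algebraMap ℂ (Module.End ℂ V) (Q.coeff k)) m (fun r => by
        rw [← hexpand, hagree, sub_self]
        exact Submodule.zero_mem _)
    have hfinal : UniversalEnvelopingAlgebra.lift ℝ (ρs s) z =
        algebraMap ℂ (Module.End ℂ V) (Q.eval s) := by
      rw [hP, ← sub_eq_zero, hexpand]
      exact Finset.sum_eq_zero fun k hk => by
        rw [(Submodule.mem_bot ℂ).1 (hzero k hk), smul_zero]
    rw [hρ's, hfinal, hθ', hQ]
  · -- every Harish-Chandra homomorphism, every enumeration
    obtain rfl : γ = γ₀ := harishChandraHomGL_unique_holds γ γ₀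
    rw [hθ']
    exact aeval_eq_aeval_of_map_univ_eq (γ₀.toAlgHom_mem_symmetricSubalgebraGL z)
      fun τ => by rw [hlt, hl']

/-! ### The twist by `Y ↦ L(tr Y)`: real and complex place factors -/

/-- The trace kills brackets. [folklore] -/
theorem trace_bracket_eq_zero (X Y : Matrix (Fin n) (Fin n) 𝕜) :
    Matrix.trace ⁅X, Y⁆ = 0 := by
  rw [LieRing.of_associative_ring_bracket, Matrix.trace_sub, Matrix.trace_mul_comm, sub_self]

/-- The trace kills the strictly upper triangular subalgebra `𝔫`. [folklore] -/
theorem trace_eq_zero_of_mem_upperNilpLie {Y : Matrix (Fin n) (Fin n) 𝕜} (hY : Y ∈ upperNilpLie 𝕜 n) :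
    Matrix.trace Y = 0 :=
  Finset.sum_eq_zero fun i _ => hY i i le_rfl

/-- **Real place factor.** On `𝔤𝔩ₙ(ℝ)`, if `ρ'` is (along `e : V ≃ V'`) the twist of `ρ` by the
scalar character `Y ↦ L(tr Y)` with `L : ℝ → ℂ` real-linear (the differential at a real place `w`
of `θ_w ∘ det` for an ARBITRARY quasi-character `θ_w` of `ℝˣ`, `L(1) ∈ ℂ`), then a Harish-Chandra
parameter `χ` of `(V, ρ)` gives the parameter `τ ↦ χ τ + L(1)` of `(V', ρ')`
(`HasHCParameter.of_add_cmul_one` with `λ = tr`, `s = L(1)`). Borel–Jacquet 1979, 5.7; Knapp 2002,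
Thm. 5.44. [cite: BorelJacquetCorvallis1979, 5.7] -/
theorem HasHCParameter.of_twist_trace_real (L : ℝ →ₗ[ℝ] ℂ) (e : V ≃ₗ[ℂ] V')
    {ρ : Matrix (Fin n) (Fin n) ℝ →ₗ⁅ℝ⁆ Module.End ℂ V}
    {ρ' : Matrix (Fin n) (Fin n) ℝ →ₗ⁅ℝ⁆ Module.End ℂ V'}
    (hrel : ∀ (Y : Matrix (Fin n) (Fin n) ℝ) (v : V), ρ' Y (e v) = e (ρ Y v + L Y.trace • v))
    {χ : (ℝ →ₐ[ℝ] ℂ) → Multiset ℂ} (hχ : HasHCParameter ρ χ) :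
    HasHCParameter ρ' fun τ => (χ τ).map (· + L 1) := by
  classical
  set lam : Matrix (Fin n) (Fin n) ℝ →ₗ[ℝ] ℝ := Matrix.traceLinearMap (Fin n) ℝ ℝ with hlam
  have hlam' : ∀ Y, lam Y = Y.trace := fun Y => rfl
  have hb : ∀ X Y : Matrix (Fin n) (Fin n) ℝ, lam ⁅X, Y⁆ = 0 := fun X Y => by
    rw [hlam', trace_bracket_eq_zero]
  have hn : ∀ Y ∈ upperNilpLie ℝ n, lam Y = 0 := fun Y hY => by
    rw [hlam', trace_eq_zero_of_mem_upperNilpLie hY]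
  have hc : ∀ h : Fin n → ℝ, ((lam (Matrix.diagonal h) : ℝ) : ℂ) =
      weightFun (fun (_ : ℝ →ₐ[ℝ] ℂ) (_ : Fin n) => (1 : ℂ)) h := fun h => by
    rw [weightFun_const, HCEmb.card_algHom_of_I_eq_zero (𝕜 := ℝ) RCLike.I_to_real, hlam',
      Matrix.trace_diagonal, RCLike.re_to_real, Nat.cast_one, one_mul, one_mul]
  obtain ⟨ρ₁, hρ₁⟩ := exists_lieHom_add_smul_one ρ ((L 1) • (Complex.ofRealAm.toLinearMap.comp lam))
    (fun X Y => by rw [LinearMap.smul_apply, LinearMap.comp_apply, hb]; simp)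
  have hρ₁' : ∀ X, ρ₁ X = ρ X + (L 1 * (lam X : ℂ)) • (1 : Module.End ℂ V) := fun X => by
    rw [hρ₁]; rfl
  have h1 : HasHCParameter ρ₁ fun τ => (χ τ).map (· + L 1 * 1) :=
    HasHCParameter.of_add_cmul_one hb hn hc (L 1) hρ₁' hχ
  simp only [mul_one] at h1
  refine HasHCParameter.of_conj e (fun Y v => ?_) h1
  rw [hrel, hρ₁', LinearMap.add_apply, LinearMap.smul_apply, Module.End.one_apply, hlam']
  congr 3
  -- `L (tr Y) = L 1 * tr Y`
  conv_lhs => rw [← mul_one Y.trace, ← smul_eq_mul, map_smul, Complex.real_smul, mul_comm]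

/-- `(im z : ℂ) = -i/2 · z + i/2 · z̄` for `z ∈ ℂ`. [folklore] -/
theorem ofReal_im_eq (z : ℂ) :
    ((z.im : ℝ) : ℂ) = -Complex.I / 2 * z + Complex.I / 2 * conj z := by
  have e₂ : z - conj z = 2 * (z.im : ℂ) * Complex.I := by
    rw [Complex.sub_conj]; push_cast; ring
  linear_combination (Complex.I / 2) * e₂ + (z.im : ℂ) * Complex.I_mul_I

/-- **Complex place factor.** On `𝔤𝔩ₙ(ℂ)` (a real Lie algebra), if `ρ'` is (along `e : V ≃ V'`)
the twist of `ρ` by the scalar character `Y ↦ L(tr Y)` with `L : ℂ → ℂ` REAL-linear — the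
differential at a complex place `w` of `θ_w ∘ det` for an ARBITRARY quasi-character `θ_w` of `ℂˣ`,
`L(a) = a p' + ā q'` with `p' - q' ∈ ℤ` but `p', q'` otherwise arbitrary complex — then a Harish-Chandra
parameter `χ` of `(V, ρ)` gives the parameter `τ ↦ χ τ + proj L τ 1` of `(V', ρ')`, where
`proj L id 1 = ½ (L 1 - i L i) = p'` and `proj L conj 1 = ½ (L 1 + i L i) = q'` (`HCEmb.proj`).
Proof: `L(tr Y) = re(tr Y) · L 1 + im(tr Y) · L i`; twice `HasHCParameter.of_add_cmul_one`, with the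
real forms `re ∘ tr` (weights `½, ½`) and `im ∘ tr` (weights `-i/2, i/2`). Borel–Jacquet 1979,
5.7; Knapp 2002, Thm. 5.44; Buzzard–Gee 2014, §3.1. [cite: BorelJacquetCorvallis1979, 5.7] -/
theorem HasHCParameter.of_twist_trace_complex (L : ℂ →ₗ[ℝ] ℂ) (e : V ≃ₗ[ℂ] V')
    {ρ : Matrix (Fin n) (Fin n) ℂ →ₗ⁅ℝ⁆ Module.End ℂ V}
    {ρ' : Matrix (Fin n) (Fin n) ℂ →ₗ⁅ℝ⁆ Module.End ℂ V'}
    (hrel : ∀ (Y : Matrix (Fin n) (Fin n) ℂ) (v : V), ρ' Y (e v) = e (ρ Y v + L Y.trace • v))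
    {χ : (ℂ →ₐ[ℝ] ℂ) → Multiset ℂ} (hχ : HasHCParameter ρ χ) :
    HasHCParameter ρ' fun τ => (χ τ).map (· + HCEmb.proj L τ 1) := by
  classical
  set lam₁ : Matrix (Fin n) (Fin n) ℂ →ₗ[ℝ] ℝ := Complex.reLm.comp (Matrix.traceLinearMap (Fin n) ℝ ℂ)
    with hlam₁
  set lam₂ : Matrix (Fin n) (Fin n) ℂ →ₗ[ℝ] ℝ := Complex.imLm.comp (Matrix.traceLinearMap (Fin n) ℝ ℂ)
    with hlam₂
  have h₁ : ∀ Y, lam₁ Y = Y.trace.re := fun Y => rfl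
  have h₂ : ∀ Y, lam₂ Y = Y.trace.im := fun Y => rfl
  have hb₁ : ∀ X Y : Matrix (Fin n) (Fin n) ℂ, lam₁ ⁅X, Y⁆ = 0 := fun X Y => by
    rw [h₁, trace_bracket_eq_zero, Complex.zero_re]
  have hb₂ : ∀ X Y : Matrix (Fin n) (Fin n) ℂ, lam₂ ⁅X, Y⁆ = 0 := fun X Y => by
    rw [h₂, trace_bracket_eq_zero, Complex.zero_im]
  have hn₁ : ∀ Y ∈ upperNilpLie ℂ n, lam₁ Y = 0 := fun Y hY => by
    rw [h₁, trace_eq_zero_of_mem_upperNilpLie hY, Complex.zero_re]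
  have hn₂ : ∀ Y ∈ upperNilpLie ℂ n, lam₂ Y = 0 := fun Y hY => by
    rw [h₂, trace_eq_zero_of_mem_upperNilpLie hY, Complex.zero_im]
  obtain ⟨huniv, hne⟩ := univ_algHom_complex_eq
  have hc₁ : ∀ h : Fin n → ℂ, ((lam₁ (Matrix.diagonal h) : ℝ) : ℂ) =
      weightFun (fun (_ : ℂ →ₐ[ℝ] ℂ) (_ : Fin n) => (2 : ℂ)⁻¹) h := fun h => by
    rw [weightFun_const, HCEmb.card_algHom_of_im_I (𝕜 := ℂ) (by simp), h₁, Matrix.trace_diagonal,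
      RCLike.re_eq_complex_re, Nat.cast_ofNat, ← mul_assoc, inv_mul_cancel₀ two_ne_zero, one_mul]
  have hc₂ : ∀ h : Fin n → ℂ, ((lam₂ (Matrix.diagonal h) : ℝ) : ℂ) =
      weightFun (fun (τ : ℂ →ₐ[ℝ] ℂ) (_ : Fin n) => conj (τ Complex.I) / 2) h := fun h => by
    rw [h₂, Matrix.trace_diagonal, Complex.im_sum, Complex.ofReal_sum]
    simp only [weightFun]
    rw [huniv, Finset.sum_pair hne, ← Finset.sum_add_distrib]
    refine Finset.sum_congr rfl fun i _ => ?_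
    simp only [AlgHom.coe_id, id_eq, AlgEquiv.coe_toAlgHom, Complex.conjAe_coe, Complex.conj_I,
      map_neg]
    rw [ofReal_im_eq]
    ring
  -- step 1: twist by `L 1 · re tr`
  obtain ⟨ρ₁, hρ₁⟩ := exists_lieHom_add_smul_one ρ ((L 1) • (Complex.ofRealAm.toLinearMap.comp lam₁))
    (fun X Y => by rw [LinearMap.smul_apply, LinearMap.comp_apply, hb₁]; simp)
  have hρ₁' : ∀ X, ρ₁ X = ρ X + (L 1 * (lam₁ X : ℂ)) • (1 : Module.End ℂ V) := fun X => by
    rw [hρ₁]; rfl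
  have hstep₁ := HasHCParameter.of_add_cmul_one hb₁ hn₁ hc₁ (L 1) hρ₁' hχ
  -- step 2: twist by `L i · im tr`
  obtain ⟨ρ₂, hρ₂⟩ := exists_lieHom_add_smul_one ρ₁
    ((L Complex.I) • (Complex.ofRealAm.toLinearMap.comp lam₂))
    (fun X Y => by rw [LinearMap.smul_apply, LinearMap.comp_apply, hb₂]; simp)
  have hρ₂' : ∀ X, ρ₂ X = ρ₁ X + (L Complex.I * (lam₂ X : ℂ)) • (1 : Module.End ℂ V) := fun X => by
    rw [hρ₂]; rfl
  have hstep₂ := HasHCParameter.of_add_cmul_one hb₂ hn₂ hc₂ (L Complex.I) hρ₂' hstep₁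
  -- the two shifts add up to `proj L τ 1`
  have hpar : (fun τ : ℂ →ₐ[ℝ] ℂ => ((χ τ).map (· + L 1 * (2 : ℂ)⁻¹)).map
      (· + L Complex.I * (conj (τ Complex.I) / 2))) = fun τ => (χ τ).map (· + HCEmb.proj L τ 1) := by
    funext τ
    rw [Multiset.map_map]
    refine Multiset.map_congr rfl fun x _ => ?_
    rw [Function.comp_apply, HCEmb.proj_def, HCEmb.card_algHom_of_im_I (𝕜 := ℂ) (by simp),
      RCLike.I_to_complex, smul_eq_mul, smul_eq_mul, smul_eq_mul, mul_one, Nat.cast_ofNat]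
    ring
  rw [← hpar]
  refine HasHCParameter.of_conj e (fun Y v => ?_) hstep₂
  rw [hrel, hρ₂', LinearMap.add_apply, hρ₁', LinearMap.add_apply, LinearMap.smul_apply,
    LinearMap.smul_apply, Module.End.one_apply, h₁, h₂, add_assoc, ← add_smul]
  congr 3
  -- `L (tr Y) = L 1 * re tr Y + L i * im tr Y`
  have e1 : ∀ r : ℝ, L (r : ℂ) = (r : ℂ) * L 1 := fun r => by
    conv_lhs => rw [show (r : ℂ) = r • (1 : ℂ) by rw [Complex.real_smul, mul_one], map_smul,
      Complex.real_smul]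
  have e2 : ∀ r : ℝ, L ((r : ℂ) * Complex.I) = (r : ℂ) * L Complex.I := fun r => by
    conv_lhs => rw [← Complex.real_smul, map_smul, Complex.real_smul]
  conv_lhs => rw [← Complex.re_add_im Y.trace, map_add, e1, e2]
  ring

end Literature.NumberTheory.Automorphic

end
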